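import Literature.Geometry.Riemannian.DistSqDirectionalDatumAux
import Literature.Geometry.Riemannian.RicciFlowThroughSingularitiesFour
import Literature.Geometry.Riemannian.ExpMapHopfRinow
import Literature.Geometry.Riemannian.NonTrappingConvexSublevelProofs
import Literature.Geometry.Riemannian.ExpMapGlobalSmooth
import Literature.Geometry.Riemannian.CyclicCoverOrbitSpace
import Literature.Geometry.Lorentzian.LeviCivitaCurvature
import Literature.Geometry.Lorentzian.MetricDetComparison
import Mathlib.Analysis.Real.Pi.Bounds
import HarnessLib

/-!
# The directional datum of `d_t²` along a compact Ricci flow: `(∂ₜ − Δ_x − Δ_y) d_t² ≥ −H_n` in the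
# directional-barrier sense (Bamler 2020a, Thm. 3.5), PROVED

R. Bamler, *Entropy and heat kernel bounds on a Ricci flow background*, arXiv:2008.07093 (2020a),
Thm. 3.5. For a `C^∞` global family `h` of Riemannian metrics on a closed connected manifold
modelled on `ℝᵐ`, `m ≥ 1`, which is a Ricci flow on the order-connected time set `S`, we produce
at every `(x, y, t)`, `t ∈ S` not the initial time, and every `η > 0`, the datum consumed by
`directional_barrier_minimum_principle` (`DirectionalBarrierMinimumPrinciple.lean`) for
`ψ = d_t²` and `c = H_m = (m − 1)π²/2 + 4`:

* `x = y` (`distSq_directional_datum_diag`): any orthonormal frame, barriers `σ²` in every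
  direction (`d(x, exp_x(σe)) ≤ |σ|`), time barrier `0`; `−4m ≥ −H_m` is `π² ≥ 8`;
* `x ≠ y` (`IsRicciFlow.distSq_directional_datum`): a minimising unit speed `h(t)`-geodesic `γ`
  from `x` to `y` of length `T = d_t(x, y)` (Hopf–Rinow); the spatial data at both ends
  (`end_distSq_barriers` at `y` along `γ` and at `x` along the reversed geodesic, whose
  `sin²`-weighted Ricci integral is the `cos²`-weighted one along `γ`,
  `integral_sin_sq_ricci_reverse`); the linear left time barrier of slope
  `−2T ∫ Ric(γ̇, γ̇) − η/4` (`IsRicciFlow.edist_toReal_sq_le_taylor_left`); and the identity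
  `p − Σbˣ − Σbʸ = −2T∫Ric − 4 − (m−1)π²/2 + 2T∫(cos² + sin²)Ric − slack = −H_m − slack`.

Everything is proved; no definitions, no named facts.

## References

* R. H. Bamler, *Entropy and heat kernel bounds on a Ricci flow background*, arXiv:2008.07093
  (2020), §3.1 Thm. 3.5, §3.2 (proof). [Bamler2020Entropy]
-/

noncomputable section

open Bundle Set Function Filter MeasureTheory intervalIntegral
open scoped Manifold ContDiff Topology ENNReal NNReal Real

namespace Literature.Geometry.Riemannian

open Lorentzian Lorentzian.PseudoRiemannianMetric

section Datum

variable {m : ℕ} {M : Type*} [TopologicalSpace M] [ChartedSpace (EuclideanSpace ℝ (Fin m)) M]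
  [IsManifold 𝓘(ℝ, EuclideanSpace ℝ (Fin m)) ∞ M] [T2Space M] [CompactSpace M] [ConnectedSpace M]
  {h : ℝ → PseudoRiemannianMetric 𝓘(ℝ, EuclideanSpace ℝ (Fin m)) ∞ (EuclideanSpace ℝ (Fin m))
    (TangentSpace 𝓘(ℝ, EuclideanSpace ℝ (Fin m)) : M → Type _)}
  [∀ r, (h r).HasLeviCivita]
  {cov : ℝ → CovariantDerivative 𝓘(ℝ, EuclideanSpace ℝ (Fin m)) (EuclideanSpace ℝ (Fin m))
    (TangentSpace 𝓘(ℝ, EuclideanSpace ℝ (Fin m)) : M → Type _)}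

/-- `8 ≤ π²` (from `π > 3`). [folklore] -/
theorem eight_le_pi_sq : (8 : ℝ) ≤ π ^ 2 := by nlinarith [Real.pi_gt_three]

omit [ConnectedSpace M] in
/-- **The directional datum of `d_t²` on the diagonal `x = y`**: any `h(t)`-orthonormal frame,
the barriers `σ²` in every direction at both slots (`d_t(x, exp_x(σe))² ≤ σ²`), the zero time
barrier, and `−H_m − η ≤ 0 − 2m − 2m` (`π² ≥ 8`, `m ≥ 1`). [cite: Bamler2020Entropy, §3.2, proof of Thm. 3.5] -/
theorem distSq_directional_datum_diag (hR : ∀ r, (h r).IsRiemannian) (hm : 0 < m) (x : M) (t : ℝ)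
    {η : ℝ} (hη : 0 < η) :
    ∃ (ex ey : Fin (Module.finrank ℝ (EuclideanSpace ℝ (Fin m))) →
        TangentSpace 𝓘(ℝ, EuclideanSpace ℝ (Fin m)) x)
      (Bx Bx' By By' : Fin (Module.finrank ℝ (EuclideanSpace ℝ (Fin m))) → ℝ → ℝ)
      (bx by_ : Fin (Module.finrank ℝ (EuclideanSpace ℝ (Fin m))) → ℝ) (Bt : ℝ → ℝ) (p : ℝ),
      (∀ i j, (h t).val x (ex i) (ex j) = if i = j then 1 else 0) ∧
      (∀ i j, (h t).val x (ey i) (ey j) = if i = j then 1 else 0) ∧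
      (∀ i, (∀ᶠ σ in 𝓝 (0 : ℝ), HasDerivAt (Bx i) (Bx' i σ) σ) ∧ HasDerivAt (Bx' i) (bx i) 0 ∧
        Bx i 0 = ((h t).edist (hR t) x x).toReal ^ 2 ∧
        ∀ᶠ σ in 𝓝 (0 : ℝ), ((h t).edist (hR t) (expMap (h t).leviCivita x (σ • ex i)) x).toReal ^ 2 ≤
          Bx i σ) ∧
      (∀ i, (∀ᶠ σ in 𝓝 (0 : ℝ), HasDerivAt (By i) (By' i σ) σ) ∧ HasDerivAt (By' i) (by_ i) 0 ∧
        By i 0 = ((h t).edist (hR t) x x).toReal ^ 2 ∧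
        ∀ᶠ σ in 𝓝 (0 : ℝ), ((h t).edist (hR t) x (expMap (h t).leviCivita x (σ • ey i))).toReal ^ 2 ≤
          By i σ) ∧
      (HasDerivWithinAt Bt p (Iic t) t ∧ Bt t = ((h t).edist (hR t) x x).toReal ^ 2 ∧
        ∀ᶠ t' in 𝓝[<] t, ((h t').edist (hR t') x x).toReal ^ 2 ≤ Bt t') ∧
      -MetricFlow.concentrationConst m - η ≤ p - ∑ i, bx i - ∑ i, by_ i := by
  classical
  set g := h t with hg_def
  haveI : Fact ((1 : ℕ∞ω) ≤ (∞ : ℕ∞ω)) := ⟨by exact_mod_cast le_top⟩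
  have h2 : (2 : ℕ∞ω) ≤ (∞ : ℕ∞ω) := WithTop.coe_le_coe.mpr le_top
  haveI : CovariantDerivative.ContMDiffCovariantDerivative g.leviCivita 1 :=
    contMDiffCovariantDerivative_leviCivita_of_two_le g h2
  haveI : CovariantDerivative.ContMDiffCovariantDerivative g.leviCivita ((⊤ : ℕ∞) : ℕ∞ω) :=
    contMDiffCovariantDerivative_leviCivita_infty g le_rfl
  have hc : IsGeodesicallyComplete g.leviCivita := isGeodesicallyComplete_of_compactSpace g h2 (hR t)
  -- an orthonormal frame at `x`
  obtain ⟨b, hb⟩ := g.exists_orthonormal_basis x (hR t)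
  -- `d(x, x) = 0`
  have hd0 : ∀ r, ((h r).edist (hR r) x x).toReal ^ 2 = 0 := fun r ↦ by
    rw [PseudoRiemannianMetric.edist_self]; simp
  -- the barrier `σ²`
  have hsq : ∀ σ : ℝ, HasDerivAt (fun σ : ℝ ↦ σ ^ 2) (2 * σ) σ := fun σ ↦
    (hasDerivAt_pow 2 σ).congr_deriv (by ring)
  have h2σ : HasDerivAt (fun σ : ℝ ↦ 2 * σ) 2 0 := ((hasDerivAt_id' (0 : ℝ)).const_mul 2).congr_deriv (by ring)
  have hdom : ∀ i, ∀ σ : ℝ, (g.edist (hR t) x (expMap g.leviCivita x (σ • b i))).toReal ^ 2 ≤ σ ^ 2 := by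
    intro i σ
    have h1 := (edist_expMap_smul_toReal_le_abs g (hR t) hc x (b i) (by rw [hb]; simp) σ).2
    calc (g.edist (hR t) x (expMap g.leviCivita x (σ • b i))).toReal ^ 2 ≤ |σ| ^ 2 :=
          pow_le_pow_left₀ ENNReal.toReal_nonneg h1 2
      _ = σ ^ 2 := sq_abs σ
  refine ⟨fun i ↦ b i, fun i ↦ b i, fun _ σ ↦ σ ^ 2, fun _ σ ↦ 2 * σ, fun _ σ ↦ σ ^ 2, fun _ σ ↦ 2 * σ,
    fun _ ↦ 2, fun _ ↦ 2, fun _ ↦ 0, 0, hb, hb, fun i ↦ ⟨Eventually.of_forall hsq, h2σ, ?_, ?_⟩,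
    fun i ↦ ⟨Eventually.of_forall hsq, h2σ, ?_, ?_⟩, ⟨?_, ?_, ?_⟩, ?_⟩
  · simp
  · refine Eventually.of_forall fun σ ↦ ?_
    rw [PseudoRiemannianMetric.edist_comm]
    exact hdom i σ
  · simp
  · exact Eventually.of_forall fun σ ↦ hdom i σ
  · exact (hasDerivAt_const t (0 : ℝ)).hasDerivWithinAt
  · exact (hd0 t).symm
  · exact Eventually.of_forall fun t' ↦ (hd0 t').le
  · -- `−H_m − η ≤ −4m`
    simp only [Finset.sum_const, Finset.card_univ, Fintype.card_fin, nsmul_eq_mul,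
      finrank_euclideanSpace_fin, MetricFlow.concentrationConst]
    have hm1 : (1 : ℝ) ≤ m := by exact_mod_cast hm
    nlinarith [eight_le_pi_sq, hm1]

omit [CompactSpace M] in
/-- **A minimising unit speed geodesic between two distinct points** of a complete connected
Riemannian manifold (Hopf–Rinow, `exists_isMinimizingUpTo_of_isGeodesicallyComplete`, in unit
speed parametrisation): `u` with `g(u, u) = 1`, `exp_x(T u) = y`, `T = d(x, y) > 0`.
[cite: LeeRiemannianManifolds2018, Cor. 6.21] -/
theorem exists_unit_minimizing
    (g : PseudoRiemannianMetric 𝓘(ℝ, EuclideanSpace ℝ (Fin m)) ∞ (EuclideanSpace ℝ (Fin m))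
      (TangentSpace 𝓘(ℝ, EuclideanSpace ℝ (Fin m)) : M → Type _)) [g.HasLeviCivita]
    [CovariantDerivative.ContMDiffCovariantDerivative g.leviCivita 1]
    (hg : g.IsRiemannian) (hc : IsGeodesicallyComplete g.leviCivita) {x y : M} (hxy : x ≠ y) :
    ∃ (u : TangentSpace 𝓘(ℝ, EuclideanSpace ℝ (Fin m)) x) (T : ℝ), 0 < T ∧ g.val x u u = 1 ∧
      expMap g.leviCivita x (T • u) = y ∧ (g.edist hg x y).toReal = T := by
  set T : ℝ := (g.edist hg x y).toReal with hT_def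
  have hTpos : 0 < T := by
    letI := g.metricSpace hg
    have : T = dist x y := rfl
    rw [this]; exact dist_pos.2 hxy
  obtain ⟨v, hmin, hq⟩ := exists_isMinimizingUpTo_of_isGeodesicallyComplete g le_rfl hg hc x y
  have h1 : y = maximalGeodesic g.leviCivita x v 1 := by
    rw [← hq]; exact expMap_eq_maximalGeodesic hc x v
  have hdist : g.edist hg x y = ENNReal.ofReal (Real.sqrt (g.val x v v)) := by
    rw [h1, ← hmin.2, length_maximalGeodesic hg hc x v 0 1, sub_zero, one_mul]
  have hTℓ : T = Real.sqrt (g.val x v v) := by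
    rw [hT_def, hdist, ENNReal.toReal_ofReal (Real.sqrt_nonneg _)]
  have hvv0 : 0 ≤ g.val x v v := by
    by_cases hv : v = 0
    · simp [hv]
    · exact (hg x v hv).le
  have hvv : g.val x v v = T ^ 2 := by rw [hTℓ, Real.sq_sqrt hvv0]
  refine ⟨T⁻¹ • v, T, hTpos, ?_, ?_, rfl⟩
  · have h2' : g.val x (T⁻¹ • v) (T⁻¹ • v) = T⁻¹ * T⁻¹ * g.val x v v := by
      simp only [map_smul, FunLike.coe_smul, Pi.smul_apply, smul_eq_mul]
      ring
    rw [h2', hvv]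
    field_simp
  · rw [smul_smul, mul_inv_cancel₀ hTpos.ne', one_smul, ← riemannianExpMap_eq]
    exact hq

set_option maxHeartbeats 400000 in
/-- **The directional datum of `d_t²` off the diagonal** (Bamler 2020a, Thm. 3.5 in the
directional-barrier sense, proved): for `x ≠ y` and `t ∈ S` not the initial time of the Ricci flow,
frames at `x` and `y` headed by the ends of a minimising `h(t)`-geodesic, the spatial barriers of
`end_distSq_barriers` at both ends, the linear left time barrier of slope
`−2T∫Ric(γ̇,γ̇) − η/4`, and `p − Σbˣ − Σbʸ ≥ −H_m − η`. [cite: Bamler2020Entropy, §3.1, Thm. 3.5] -/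
theorem IsRicciFlow.distSq_directional_datum_offDiag (hh : IsContMDiffFamilyOn ∞ h univ)
    (hR : ∀ r, (h r).IsRiemannian) {S : Set ℝ} (hS : S.OrdConnected) (hflow : IsRicciFlow h cov S)
    {x y : M} (hxy : x ≠ y) {t : ℝ} (ht : t ∈ S) (hleft : ∃ s ∈ S, s < t) {η : ℝ} (hη : 0 < η) :
    ∃ (ex : Fin (Module.finrank ℝ (EuclideanSpace ℝ (Fin m))) →
        TangentSpace 𝓘(ℝ, EuclideanSpace ℝ (Fin m)) x)
      (ey : Fin (Module.finrank ℝ (EuclideanSpace ℝ (Fin m))) →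
        TangentSpace 𝓘(ℝ, EuclideanSpace ℝ (Fin m)) y)
      (Bx Bx' By By' : Fin (Module.finrank ℝ (EuclideanSpace ℝ (Fin m))) → ℝ → ℝ)
      (bx by_ : Fin (Module.finrank ℝ (EuclideanSpace ℝ (Fin m))) → ℝ) (Bt : ℝ → ℝ) (p : ℝ),
      (∀ i j, (h t).val x (ex i) (ex j) = if i = j then 1 else 0) ∧
      (∀ i j, (h t).val y (ey i) (ey j) = if i = j then 1 else 0) ∧
      (∀ i, (∀ᶠ σ in 𝓝 (0 : ℝ), HasDerivAt (Bx i) (Bx' i σ) σ) ∧ HasDerivAt (Bx' i) (bx i) 0 ∧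
        Bx i 0 = ((h t).edist (hR t) x y).toReal ^ 2 ∧
        ∀ᶠ σ in 𝓝 (0 : ℝ), ((h t).edist (hR t) (expMap (h t).leviCivita x (σ • ex i)) y).toReal ^ 2 ≤
          Bx i σ) ∧
      (∀ i, (∀ᶠ σ in 𝓝 (0 : ℝ), HasDerivAt (By i) (By' i σ) σ) ∧ HasDerivAt (By' i) (by_ i) 0 ∧
        By i 0 = ((h t).edist (hR t) x y).toReal ^ 2 ∧
        ∀ᶠ σ in 𝓝 (0 : ℝ), ((h t).edist (hR t) x (expMap (h t).leviCivita y (σ • ey i))).toReal ^ 2 ≤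
          By i σ) ∧
      (HasDerivWithinAt Bt p (Iic t) t ∧ Bt t = ((h t).edist (hR t) x y).toReal ^ 2 ∧
        ∀ᶠ t' in 𝓝[<] t, ((h t').edist (hR t') x y).toReal ^ 2 ≤ Bt t') ∧
      -MetricFlow.concentrationConst m - η ≤ p - ∑ i, bx i - ∑ i, by_ i := by
  classical
  set g := h t with hg_def
  haveI : Fact ((1 : ℕ∞ω) ≤ (∞ : ℕ∞ω)) := ⟨by exact_mod_cast le_top⟩
  have h2 : (2 : ℕ∞ω) ≤ (∞ : ℕ∞ω) := WithTop.coe_le_coe.mpr le_top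
  haveI : CovariantDerivative.ContMDiffCovariantDerivative g.leviCivita 1 :=
    contMDiffCovariantDerivative_leviCivita_of_two_le g h2
  haveI : CovariantDerivative.ContMDiffCovariantDerivative g.leviCivita ((⊤ : ℕ∞) : ℕ∞ω) :=
    contMDiffCovariantDerivative_leviCivita_infty g le_rfl
  have hc : IsGeodesicallyComplete g.leviCivita := isGeodesicallyComplete_of_compactSpace g h2 (hR t)
  have hg : g.IsRiemannian := hR t
  -- a minimizing unit speed geodesic from `x` to `y`, `T = d_t(x, y) > 0`
  obtain ⟨u, T, hTpos, hu, hxTu, hT⟩ := exists_unit_minimizing g hg hc hxy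
  -- the geodesic `γ(s) = exp_x(su)`
  obtain ⟨hγs, hγ0, hspeed⟩ := contMDiff_and_unit_speed_expMap_smul g hc x u hu
  rw [zero_smul] at hγ0
  set γ : ℝ → M := fun s ↦ expMap g.leviCivita x (s • u) with hγ_def
  have hγ0' : γ 0 = x := by show expMap g.leviCivita x ((0 : ℝ) • u) = x; rw [zero_smul]; exact hγ0
  have hγT : γ T = y := hxTu
  -- the slack
  have hε : 0 < η / 4 := by positivity
  -- the `y`-end
  obtain ⟨ey, By, By', by_, hony, hBy, hsumy⟩ := end_distSq_barriers g hg hc x u hu hTpos hε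
  -- the `x`-end, along the reversed geodesic
  obtain ⟨hu'unit, hrev⟩ := expMap_smul_neg_velocity_eq g hc x u hu T
  obtain ⟨ex, Bx, Bx', bx, honx, hBx, hsumx⟩ :=
    end_distSq_barriers g hg hc (expMap g.leviCivita x (T • u)) (-velocity 𝓘(ℝ, EuclideanSpace ℝ (Fin m)) γ T)
      hu'unit hTpos hε
  have hxend : expMap g.leviCivita (expMap g.leviCivita x (T • u))
      (T • (-velocity 𝓘(ℝ, EuclideanSpace ℝ (Fin m)) γ T)) = x := by
    rw [hrev T, sub_self, zero_smul]; exact hγ0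
  rw [integral_sin_sq_ricci_reverse g hc x u hu hTpos] at hsumx
  rw [hxend] at honx hBx
  rw [hxTu] at hony hBy
  -- the time barrier (flow equation)
  have hspeed' : ∀ s ∈ Icc (0 : ℝ) T, (h t).val (γ s) (velocity 𝓘(ℝ, EuclideanSpace ℝ (Fin m)) γ s)
      (velocity 𝓘(ℝ, EuclideanSpace ℝ (Fin m)) γ s) = 1 := fun s _ ↦ hspeed s
  have hdistγ : ((h t).edist (hR t) (γ 0) (γ T)).toReal = T := by rw [hγ0', hγT]; exact hT
  have htime := hflow.edist_toReal_sq_le_taylor_left hh hR hS ht hleft hγs hTpos hspeed' hdistγ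
    (η / 4) hε
  rw [hγ0', hγT] at htime
  -- the Ricci integrand along `γ`: `(cov t).ricci = g.ricci`
  set Rfun : ℝ → ℝ := fun s ↦ g.leviCivita.ricci (γ s) (velocity 𝓘(ℝ, EuclideanSpace ℝ (Fin m)) γ s)
    (velocity 𝓘(ℝ, EuclideanSpace ℝ (Fin m)) γ s) with hRfun
  have hcovR : ∀ s, (cov t).ricci (γ s) (velocity 𝓘(ℝ, EuclideanSpace ℝ (Fin m)) γ s)
      (velocity 𝓘(ℝ, EuclideanSpace ℝ (Fin m)) γ s) = Rfun s := by
    intro s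
    have := IsLeviCivita.ricci_eq_ricci (hflow.isLeviCivita t ht) h2 (γ s)
    simp only [hRfun, this]
    rfl
  have hIcov : ∫ s in (0 : ℝ)..T, (cov t).ricci (γ s) (velocity 𝓘(ℝ, EuclideanSpace ℝ (Fin m)) γ s)
      (velocity 𝓘(ℝ, EuclideanSpace ℝ (Fin m)) γ s) = ∫ s in (0 : ℝ)..T, Rfun s :=
    intervalIntegral.integral_congr fun s _ ↦ hcovR s
  rw [hIcov] at htime
  -- `∫ sin² R + ∫ cos² R = ∫ R`
  have hRc : Continuous Rfun := by
    have hTl := contMDiff_lift_velocity_of_contMDiff (I := 𝓘(ℝ, EuclideanSpace ℝ (Fin m))) hγs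
    exact (show ContMDiff 𝓘(ℝ, ℝ) 𝓘(ℝ, ℝ) ∞ _ from fun s ↦ contMDiffAt_ricci_apply_along g (hTl s) (hTl s)).continuous
  have hsplit : (∫ s in (0 : ℝ)..T, Real.sin (π * s / (2 * T)) ^ 2 * Rfun s) +
      (∫ s in (0 : ℝ)..T, Real.cos (π * s / (2 * T)) ^ 2 * Rfun s) = ∫ s in (0 : ℝ)..T, Rfun s := by
    have harg : Continuous fun s : ℝ ↦ π * s / (2 * T) := (continuous_const.mul continuous_id).div_const _
    have hi1 : IntervalIntegrable (fun s ↦ Real.sin (π * s / (2 * T)) ^ 2 * Rfun s) volume 0 T :=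
      (((Real.continuous_sin.comp harg).pow 2).mul hRc).intervalIntegrable _ _
    have hi2 : IntervalIntegrable (fun s ↦ Real.cos (π * s / (2 * T)) ^ 2 * Rfun s) volume 0 T :=
      (((Real.continuous_cos.comp harg).pow 2).mul hRc).intervalIntegrable _ _
    rw [← intervalIntegral.integral_add hi1 hi2]
    refine intervalIntegral.integral_congr fun s _ ↦ ?_
    have := Real.sin_sq_add_cos_sq (π * s / (2 * T))
    show Real.sin (π * s / (2 * T)) ^ 2 * Rfun s + Real.cos (π * s / (2 * T)) ^ 2 * Rfun s = Rfun s
    linear_combination this * Rfun s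
  -- the linear time barrier
  set p : ℝ := -(2 * T * ∫ s in (0 : ℝ)..T, Rfun s) - η / 4 with hp
  set Bt : ℝ → ℝ := fun t' ↦ (g.edist hg x y).toReal ^ 2 + p * (t' - t) with hBt
  have hBtd : HasDerivWithinAt Bt p (Iic t) t := by
    have := (((hasDerivAt_id' t).sub_const t).const_mul p).const_add ((g.edist hg x y).toReal ^ 2)
    exact (this.congr_deriv (by ring)).hasDerivWithinAt
  -- assembly
  refine ⟨ex, ey, Bx, Bx', By, By', bx, by_, Bt, p, honx, hony, fun i ↦ ?_, fun i ↦ ?_,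
    ⟨hBtd, by simp only [hBt, sub_self, mul_zero, add_zero]; rfl, ?_⟩, ?_⟩
  · obtain ⟨hd1, hd2, hB0, hdom⟩ := hBx i
    refine ⟨hd1, hd2, by rw [hB0]; show T ^ 2 = (g.edist hg x y).toReal ^ 2; rw [hT], ?_⟩
    filter_upwards [hdom] with σ hσ
    rw [PseudoRiemannianMetric.edist_comm]
    rwa [hxTu] at hσ
  · obtain ⟨hd1, hd2, hB0, hdom⟩ := hBy i
    exact ⟨hd1, hd2, by rw [hB0]; show T ^ 2 = (g.edist hg x y).toReal ^ 2; rw [hT], hdom⟩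
  · filter_upwards [htime] with t' ht'
    show _ ≤ (g.edist hg x y).toReal ^ 2 + p * (t' - t)
    convert ht' using 2
  · -- the main inequality
    have hfr : (Module.finrank ℝ (EuclideanSpace ℝ (Fin m)) : ℝ) = m := by simp
    rw [hfr] at hsumx hsumy
    have e2 : 2 * T * ((∫ s in (0 : ℝ)..T, Real.sin (π * s / (2 * T)) ^ 2 * Rfun s) +
        (∫ s in (0 : ℝ)..T, Real.cos (π * s / (2 * T)) ^ 2 * Rfun s)) = 2 * T * ∫ s in (0 : ℝ)..T, Rfun s := by
      rw [hsplit]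
    change ∑ i, bx i ≤ 2 + ((m : ℝ) - 1) * (π ^ 2 / 4) -
        2 * T * (∫ s in (0 : ℝ)..T, Real.cos (π * s / (2 * T)) ^ 2 * Rfun s) + η / 4 at hsumx
    change ∑ i, by_ i ≤ 2 + ((m : ℝ) - 1) * (π ^ 2 / 4) -
        2 * T * (∫ s in (0 : ℝ)..T, Real.sin (π * s / (2 * T)) ^ 2 * Rfun s) + η / 4 at hsumy
    simp only [MetricFlow.concentrationConst, hp]
    linarith

/-- **The directional datum of `d_t²` along a compact Ricci flow** — Bamler 2020a, Thm. 3.5 in the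
directional-barrier sense, PROVED: at every `(x, y, t)` with `t ∈ S` not the initial time and for
every `η > 0`, the datum consumed by `directional_barrier_minimum_principle` with `ψ = d_t²` and
`c = H_m`. [cite: Bamler2020Entropy, §3.1, Thm. 3.5] -/
theorem IsRicciFlow.distSq_directional_datum (hh : IsContMDiffFamilyOn ∞ h univ)
    (hR : ∀ r, (h r).IsRiemannian) {S : Set ℝ} (hS : S.OrdConnected) (hflow : IsRicciFlow h cov S)
    (hm : 0 < m) (x y : M) {t : ℝ} (ht : t ∈ S) (hleft : ∃ s ∈ S, s < t) {η : ℝ} (hη : 0 < η) :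
    ∃ (ex : Fin (Module.finrank ℝ (EuclideanSpace ℝ (Fin m))) →
        TangentSpace 𝓘(ℝ, EuclideanSpace ℝ (Fin m)) x)
      (ey : Fin (Module.finrank ℝ (EuclideanSpace ℝ (Fin m))) →
        TangentSpace 𝓘(ℝ, EuclideanSpace ℝ (Fin m)) y)
      (Bx Bx' By By' : Fin (Module.finrank ℝ (EuclideanSpace ℝ (Fin m))) → ℝ → ℝ)
      (bx by_ : Fin (Module.finrank ℝ (EuclideanSpace ℝ (Fin m))) → ℝ) (Bt : ℝ → ℝ) (p : ℝ),
      (∀ i j, (h t).val x (ex i) (ex j) = if i = j then 1 else 0) ∧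
      (∀ i j, (h t).val y (ey i) (ey j) = if i = j then 1 else 0) ∧
      (∀ i, (∀ᶠ σ in 𝓝 (0 : ℝ), HasDerivAt (Bx i) (Bx' i σ) σ) ∧ HasDerivAt (Bx' i) (bx i) 0 ∧
        Bx i 0 = ((h t).edist (hR t) x y).toReal ^ 2 ∧
        ∀ᶠ σ in 𝓝 (0 : ℝ), ((h t).edist (hR t) (expMap (h t).leviCivita x (σ • ex i)) y).toReal ^ 2 ≤
          Bx i σ) ∧
      (∀ i, (∀ᶠ σ in 𝓝 (0 : ℝ), HasDerivAt (By i) (By' i σ) σ) ∧ HasDerivAt (By' i) (by_ i) 0 ∧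
        By i 0 = ((h t).edist (hR t) x y).toReal ^ 2 ∧
        ∀ᶠ σ in 𝓝 (0 : ℝ), ((h t).edist (hR t) x (expMap (h t).leviCivita y (σ • ey i))).toReal ^ 2 ≤
          By i σ) ∧
      (HasDerivWithinAt Bt p (Iic t) t ∧ Bt t = ((h t).edist (hR t) x y).toReal ^ 2 ∧
        ∀ᶠ t' in 𝓝[<] t, ((h t').edist (hR t') x y).toReal ^ 2 ≤ Bt t') ∧
      -MetricFlow.concentrationConst m - η ≤ p - ∑ i, bx i - ∑ i, by_ i := by
  by_cases hxy : x = y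
  · subst hxy
    exact distSq_directional_datum_diag hR hm x t hη
  · exact hflow.distSq_directional_datum_offDiag hh hR hS hxy ht hleft hη

end Datum

end Literature.Geometry.Riemannian

end
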